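import Summits.QuantumFields.YangMills.Theorems.FlatTubeReductionReferenceFibreTail
import HarnessLib

/-!
# ABSOLUTE forms of the reference-density bounds: the mass of `ρ₁ = fpTriple β Ω (fpWeight ε) 1 1` on ANY fibre set `{v ∈ R}` from above, and its total mass from below,
# both with the common factor `K₁(1,1) = e^{2β|E|}` explicit — so that numerators computed with a RE-WEIGHTED profile `Ω̃ = Ω·(1+β‖v̂‖²)^j` can be divided by the floor of `Ω`
# (route `FlatTubeReduction`, crux K1 `NearFlatRatioLaw` stmt-QuantumFields-24720; seat `ym-line-ftr-p1` g12; rate twin «ratepack-v3 / frozen fibres»; R2b1 RECORD rung — no summit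
# statement is proved here)

WHY (memo `Cruxes/NearFlatRatioLaw/Lines/ratepack-v3-frozen-g12.md` §5.11 (1)).  The core weights of the moment sandwich carry fibre factors `(1+β‖v̂‖²)^j` besides the kinetic level;
the cleanest bookkeeping absorbs them into the profile (`fpTriple β Ω̃ W 1 1 = fpTriple β Ω W 1 1·(1+β‖v̂‖²)^j(1+β‖v̂′‖²)^j` pointwise) and divides ABSOLUTE numerators for `Ω̃` by the
ABSOLUTE floor for `Ω`.  This file exports the two absolute bounds that `…ReferenceFibreTail` proved internally:
* ★★ `reference_mass_on_fibreSet_le` — `∫_{v ∈ R} ρ₁ dμP ≤ K₁(1,1)·C_g·[t_R·I₀ + t_R^{(3n)}·I₀ + t_R·M_{3n}]`, `t_R = ∫_R Ω`, `t_R^{(3n)} = ∫_R Ω(√β·5√2‖v̂‖)^{3n}`, `C_g` of `gauge_gaussian_mass_le`;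
* ★★ `reference_mass_ge_floor` — `K₁(1,1)·c₁·fpZ ε·(ρ³/10)^n·θ² ≤ ∫ρ₁ dμP`.
HONEST FRAMING: assembly bookkeeping; femto rung R2b1 (RECORD label); not infinite volume, not a gap, not Clay.  No defs, no named facts, no `sorry`.
-/

set_option autoImplicit false

noncomputable section

open MeasureTheory Filter Topology Real Set
open scoped BigOperators ENNReal
open Literature.MathematicalPhysics.QuantumFieldTheory
open Literature.MathematicalPhysics.QuantumLattice

namespace Summit.QuantumFields.YangMills.Theorems.FemtoTransferGap.RateTube

open Summit.QuantumFields.YangMills.Theorems.FemtoTransferGap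
open Summit.QuantumFields.YangMills.Theorems.FemtoTransferGap.TwoLattice
open Summit.QuantumFields.YangMills.Theorems.FemtoTransferGap.TwoLattice.ConstTube
open Summit.QuantumFields.YangMills.Theorems.FemtoTransferGap.TwoLattice.Avg
open Summit.QuantumFields.YangMills.Theorems.FemtoTransferGap.TwoLattice.Cov
open Summit.QuantumFields.YangMills.Theorems.FemtoTransferGap.TwoLattice.Stiff (LinkSpace)

variable {L : ℕ} [NeZero L]

set_option maxHeartbeats 800000 in
/-- ★★ **Mass of the reference density on a fibre set, absolute form.**  `β > 0`, profile `Ω` as usual, `R` a measurable set of fibres: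
`∫_{p : v ∈ R} ρ₁ dμP ≤ K₁(1,1)·[5e4^{3n}(3n)!·fpZ ε(π²/12)^n(3L)^{3n}3^{3n}(√β)^{-3n}]·(t_R·I₀ + t_R^{(3n)}·I₀ + t_R·M_{3n})`. [cite: Luscher1983, §3] -/
theorem reference_mass_on_fibreSet_le {β : ℝ} (hβ : 0 < β) {Ω : LinkSpace L → ℝ} (hΩm : Measurable Ω) {CΩ : ℝ} (hCΩ : ∀ x, |Ω x| ≤ CΩ) (hΩ0 : ∀ x, 0 ≤ Ω x) {R : ℝ}
    (hΩt : ∀ v : Edge 3 L → Fin 3 → ℝ, Ω (linkEmbed L v) ≠ 0 → v ∈ capBalancedSet L ∧ ‖linkEmbed L v‖ ≤ R) (ε : ℝ)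
    {Rg : Set (Edge 3 L → Fin 3 → ℝ)} (hRg : MeasurableSet Rg) :
    ∫ p in {p : (Edge 3 L → Fin 3 → ℝ) × ((Edge 3 L → Fin 3 → ℝ) × (Site 3 L → SU2)) | p.1 ∈ Rg},
        fpTriple L β Ω (fpWeight L ε) 1 1 p ∂((orthoTransverse L).prod ((orthoTransverse L).prod (gaugeMeasure L))) ≤
      transferKernel su2Rep ((L : ℝ) ^ 3 * β) (1 : GaugeConfig 3 1 SU2) 1 *
        ((5 * Real.exp 1 * 4 ^ (3 * Fintype.card {x : Site 3 L // ¬x = 0}) * (3 * Fintype.card {x : Site 3 L // ¬x = 0}).factorial *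
          (fpZ ε * (π ^ 2 / 12) ^ Fintype.card {x : Site 3 L // ¬x = 0} * (3 * (L : ℝ)) ^ (3 * Fintype.card {x : Site 3 L // ¬x = 0}) *
            3 ^ (3 * Fintype.card {x : Site 3 L // ¬x = 0}) * ((Real.sqrt β)⁻¹) ^ (3 * Fintype.card {x : Site 3 L // ¬x = 0}))) *
        ((∫ v in Rg, Ω (linkEmbed L v) ∂orthoTransverse L) * (∫ v, Ω (linkEmbed L v) ∂orthoTransverse L) +
          (∫ v in Rg, Ω (linkEmbed L v) * (Real.sqrt β * (5 * (Real.sqrt 2 * ‖linkEmbed L v‖))) ^ (3 * Fintype.card {x : Site 3 L // ¬x = 0}) ∂orthoTransverse L) *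
            (∫ v, Ω (linkEmbed L v) ∂orthoTransverse L) +
          (∫ v in Rg, Ω (linkEmbed L v) ∂orthoTransverse L) *
            ∫ v, Ω (linkEmbed L v) * (Real.sqrt β * (Real.sqrt 2 * ‖linkEmbed L v‖)) ^ (3 * Fintype.card {x : Site 3 L // ¬x = 0}) ∂orthoTransverse L)) := by
  haveI := isFiniteMeasure_orthoTransverse L
  haveI : SecondCountableTopology SU2 := secondCountableTopology_su2
  set n : ℕ := Fintype.card {x : Site 3 L // ¬x = 0} with hn
  set π' := orthoTransverse L with hπ
  set μP : Measure ((Edge 3 L → Fin 3 → ℝ) × ((Edge 3 L → Fin 3 → ℝ) × (Site 3 L → SU2))) := π'.prod (π'.prod (gaugeMeasure L)) with hμP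
  haveI : IsFiniteMeasure μP := by rw [hμP]; infer_instance
  set K1 : ℝ := transferKernel su2Rep ((L : ℝ) ^ 3 * β) (1 : GaugeConfig 3 1 SU2) 1 with hK1
  have hK1p : 0 < K1 := transferKernel_pos _ _ _ _
  have hle : Measurable (linkEmbed L) := measurable_linkEmbed L
  have hfw : Measurable (fpWeight L ε) := measurable_fpWeight L ε
  have hCΩ0 : 0 ≤ CΩ := (abs_nonneg _).trans (hCΩ 0)
  have hZ0 : 0 ≤ fpZ ε := by unfold fpZ; exact measureReal_nonneg
  set sβ : ℝ := (Real.sqrt β)⁻¹ with hsβ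
  -- the region and the dominating integrand `Φ(p) = 𝟙_R(v) Ω(v̂) · (fpWeight(g) e^{-β kin}) · Ω(v̂′)`
  have hRgm : MeasurableSet Rg := hRg
  set Rp : Set ((Edge 3 L → Fin 3 → ℝ) × ((Edge 3 L → Fin 3 → ℝ) × (Site 3 L → SU2))) := {p | p.1 ∈ Rg} with hRp
  have hRpm : MeasurableSet Rp := measurable_fst hRgm
  set G : (Edge 3 L → Fin 3 → ℝ) → ℝ := fun v => Rg.indicator (fun v => Ω (linkEmbed L v)) v with hG
  have hGm : Measurable G := (hΩm.comp hle).indicator hRgm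
  have hG0 : ∀ v, 0 ≤ G v := fun v => Set.indicator_nonneg (fun w _ => hΩ0 _) _
  have hGle : ∀ v, G v ≤ Ω (linkEmbed L v) := fun v => Set.indicator_le_self' (fun w _ => hΩ0 _) v
  have hGb : ∀ v, |G v| ≤ CΩ := fun v => by rw [abs_of_nonneg (hG0 v)]; exact (hGle v).trans ((le_abs_self _).trans (hCΩ _))
  set Φ : (Edge 3 L → Fin 3 → ℝ) × ((Edge 3 L → Fin 3 → ℝ) × (Site 3 L → SU2)) → ℝ := fun p =>
    G p.1 * ((fpWeight L ε p.2.2 * Real.exp (-(β * kinDefect L (orthoTube L 1 p.1) (orthoTube L 1 p.2.1) p.2.2))) * Ω (linkEmbed L p.2.1)) with hΦ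
  have hNm' := (continuous_kinDefect_joint (L := L)).measurable.comp
    (((measurable_orthoTube_right (L := L) 1).comp measurable_fst).prodMk
      (((measurable_orthoTube_right (L := L) 1).comp (measurable_fst.comp measurable_snd)).prodMk (measurable_snd.comp measurable_snd)))
  have hexpm : Measurable fun p : (Edge 3 L → Fin 3 → ℝ) × ((Edge 3 L → Fin 3 → ℝ) × (Site 3 L → SU2)) =>
      Real.exp (-(β * kinDefect L (orthoTube L 1 p.1) (orthoTube L 1 p.2.1) p.2.2)) := Real.measurable_exp.comp (hNm'.const_mul β).neg
  have hΦm : Measurable Φ := (hGm.comp measurable_fst).mul (((hfw.comp (measurable_snd.comp measurable_snd)).mul hexpm).mul (hΩm.comp (hle.comp (measurable_fst.comp measurable_snd))))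
  have hexp1 : ∀ p : (Edge 3 L → Fin 3 → ℝ) × ((Edge 3 L → Fin 3 → ℝ) × (Site 3 L → SU2)), Real.exp (-(β * kinDefect L (orthoTube L 1 p.1) (orthoTube L 1 p.2.1) p.2.2)) ≤ 1 := fun p =>
    Real.exp_le_one_iff.mpr (by nlinarith [kinDefect_nonneg (orthoTube L 1 p.1) (orthoTube L 1 p.2.1) p.2.2, hβ.le])
  have hΦ0 : ∀ p, 0 ≤ Φ p := fun p => mul_nonneg (hG0 _) (mul_nonneg (mul_nonneg (fpWeight_mem_Icc L ε _).1 (Real.exp_pos _).le) (hΩ0 _))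
  have hΦb : ∀ p, |Φ p| ≤ CΩ * CΩ := fun p => by
    rw [abs_of_nonneg (hΦ0 p), hΦ]
    calc G p.1 * (fpWeight L ε p.2.2 * Real.exp (-(β * kinDefect L (orthoTube L 1 p.1) (orthoTube L 1 p.2.1) p.2.2)) * Ω (linkEmbed L p.2.1)) ≤ CΩ * (1 * 1 * CΩ) :=
          mul_le_mul ((le_abs_self _).trans (hGb _)) (mul_le_mul (mul_le_mul (fpWeight_mem_Icc L ε _).2 (hexp1 p) (Real.exp_pos _).le zero_le_one)
            ((le_abs_self _).trans (hCΩ _)) (hΩ0 _) (by norm_num)) (mul_nonneg (mul_nonneg (fpWeight_mem_Icc L ε _).1 (Real.exp_pos _).le) (hΩ0 _)) hCΩ0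
      _ = CΩ * CΩ := by ring
  have hΦi : Integrable Φ μP := integrable_of_measurable_abs_le _ hΦm hΦb
  -- `𝟙_Rp · ρ₁ ≤ K1 · Φ`
  have hdom : ∀ p, Rp.indicator (fun p => fpTriple L β Ω (fpWeight L ε) 1 1 p) p ≤ K1 * Φ p := by
    intro p
    by_cases hp : p ∈ Rp
    · rw [Set.indicator_of_mem hp, hΦ]; dsimp only
      have hv : p.1 ∈ Rg := hp
      rw [hG]; dsimp only; rw [Set.indicator_of_mem hv]
      have hk := kernelRatio_le (L := L) hβ.le p.1 p.2.1 p.2.2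
      rw [div_le_iff₀ hK1p] at hk
      unfold fpTriple
      have hW0 := (fpWeight_mem_Icc L ε p.2.2).1
      calc Ω (linkEmbed L p.1) * (fpWeight L ε p.2.2 * transferKernel su2Rep β (orthoTube L 1 p.1) (gaugeTransform p.2.2 (orthoTube L 1 p.2.1)) * Ω (linkEmbed L p.2.1))
          ≤ Ω (linkEmbed L p.1) * (fpWeight L ε p.2.2 * (Real.exp (-(β * kinDefect L (orthoTube L 1 p.1) (orthoTube L 1 p.2.1) p.2.2)) * K1) * Ω (linkEmbed L p.2.1)) :=
            mul_le_mul_of_nonneg_left (mul_le_mul_of_nonneg_right (mul_le_mul_of_nonneg_left hk hW0) (hΩ0 _)) (hΩ0 _)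
        _ = K1 * (Ω (linkEmbed L p.1) * (fpWeight L ε p.2.2 * Real.exp (-(β * kinDefect L (orthoTube L 1 p.1) (orthoTube L 1 p.2.1) p.2.2)) * Ω (linkEmbed L p.2.1))) := by ring
    · rw [Set.indicator_of_notMem hp]; exact mul_nonneg hK1p.le (hΦ0 p)
  -- integrability of ρ₁
  obtain ⟨Bρ, hBρ⟩ := abs_fpTriple_le (L := L) β hCΩ (CW := 1) (fun g => by rw [abs_of_nonneg (fpWeight_mem_Icc L ε g).1]; exact (fpWeight_mem_Icc L ε g).2) (1 : GaugeConfig 3 1 SU2) 1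
  have hρm : Measurable fun p => fpTriple L β Ω (fpWeight L ε) 1 1 p := measurable_fpTriple β hΩm hfw 1 1
  have hρi : Integrable (fun p => fpTriple L β Ω (fpWeight L ε) 1 1 p) μP := integrable_of_measurable_abs_le _ hρm hBρ
  have hnum : ∫ p in Rp, fpTriple L β Ω (fpWeight L ε) 1 1 p ∂μP ≤ K1 * ∫ p, Φ p ∂μP := by
    rw [← integral_indicator hRpm, ← integral_const_mul]
    exact integral_mono (hρi.indicator hRpm) (hΦi.const_mul K1) hdom
  -- Fubini for `Φ` and the inner gauge bound
  set Cg : ℝ := 5 * Real.exp 1 * 4 ^ (3 * n) * (3 * n).factorial * (fpZ ε * (π ^ 2 / 12) ^ n * (3 * (L : ℝ)) ^ (3 * n) * 3 ^ (3 * n) * sβ ^ (3 * n)) with hCg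
  have hCg0 : 0 ≤ Cg := by rw [hCg]; positivity
  have hsec : ∀ v : Edge 3 L → Fin 3 → ℝ, Integrable (fun q : (Edge 3 L → Fin 3 → ℝ) × (Site 3 L → SU2) => Φ (v, q)) (π'.prod (gaugeMeasure L)) := fun v =>
    integrable_of_measurable_abs_le _ (hΦm.comp measurable_prodMk_left) fun q => hΦb (v, q)
  have hinner_g : ∀ v v' : Edge 3 L → Fin 3 → ℝ, ∫ g, Φ (v, (v', g)) ∂gaugeMeasure L ≤
      G v * Ω (linkEmbed L v') * (Cg * (1 + (Real.sqrt β * (5 * (Real.sqrt 2 * ‖linkEmbed L v‖))) ^ (3 * n) + (Real.sqrt β * (Real.sqrt 2 * ‖linkEmbed L v'‖)) ^ (3 * n))) := by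
    intro v v'
    have e : ∀ g, Φ (v, (v', g)) = G v * Ω (linkEmbed L v') * (fpWeight L ε g * Real.exp (-(β * kinDefect L (orthoTube L 1 v) (orthoTube L 1 v') g))) := fun g => by
      rw [hΦ]; dsimp only; ring
    rw [integral_congr_ae (ae_of_all _ e), integral_const_mul]
    have hGΩ0 : 0 ≤ G v * Ω (linkEmbed L v') := mul_nonneg (hG0 _) (hΩ0 _)
    by_cases hz : G v * Ω (linkEmbed L v') = 0
    · rw [hz, zero_mul, zero_mul]
    · have hGv : G v ≠ 0 := fun h => hz (by rw [h, zero_mul])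
      have hΩv : Ω (linkEmbed L v) ≠ 0 := fun h => hGv (by
        have := hGle v; have h0 := hG0 v; rw [h] at this; exact le_antisymm this h0)
      have hΩv' : Ω (linkEmbed L v') ≠ 0 := fun h => hz (by rw [h, mul_zero])
      have hv1 : ∀ e : Edge 3 L, ∑ a, v e a ^ 2 ≤ 1 := sum_sq_le_one_of_cap L (hΩt v hΩv).1.2
      have hv'1 : ∀ e : Edge 3 L, ∑ a, v' e a ^ 2 ≤ 1 := sum_sq_le_one_of_cap L (hΩt v' hΩv').1.2
      have ha : ∀ e, ‖su2Quat (orthoTube L 1 v e) - 1‖ ≤ Real.sqrt 2 * ‖linkEmbed L v‖ := fun e => by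
        have h := norm_su2Quat_orthoTube_sub_one_le (1 : GaugeConfig 3 1 SU2) hv1 e
        rw [Pi.one_apply, su2Quat_one, sub_self, norm_zero, add_zero] at h; exact h
      have ha' : ∀ e, ‖su2Quat (orthoTube L 1 v' e) - 1‖ ≤ Real.sqrt 2 * ‖linkEmbed L v'‖ := fun e => by
        have h := norm_su2Quat_orthoTube_sub_one_le (1 : GaugeConfig 3 1 SU2) hv'1 e
        rw [Pi.one_apply, su2Quat_one, sub_self, norm_zero, add_zero] at h; exact h
      have h := gauge_gaussian_mass_le (L := L) hβ ε (orthoTube L 1 v) (orthoTube L 1 v') (by positivity) (by positivity) ha ha'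
      refine mul_le_mul_of_nonneg_left (h.trans (le_of_eq ?_)) hGΩ0
      rw [hCg]; ring
  -- integrate over v′ and v
  have hmom_m : Measurable fun v : Edge 3 L → Fin 3 → ℝ => Ω (linkEmbed L v) * (Real.sqrt β * (Real.sqrt 2 * ‖linkEmbed L v‖)) ^ (3 * n) :=
    (hΩm.comp hle).mul (((hle.norm.const_mul _).const_mul _).pow_const _)
  have hmom_b : ∀ v : Edge 3 L → Fin 3 → ℝ, |Ω (linkEmbed L v) * (Real.sqrt β * (Real.sqrt 2 * ‖linkEmbed L v‖)) ^ (3 * n)| ≤ CΩ * (Real.sqrt β * (Real.sqrt 2 * |R|)) ^ (3 * n) := fun v => by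
    by_cases hzv : Ω (linkEmbed L v) = 0
    · rw [hzv, zero_mul, abs_zero]; positivity
    · rw [abs_mul, abs_of_nonneg (by positivity : 0 ≤ (Real.sqrt β * (Real.sqrt 2 * ‖linkEmbed L v‖)) ^ (3 * n))]
      exact mul_le_mul (hCΩ _) (pow_le_pow_left₀ (by positivity)
        (mul_le_mul_of_nonneg_left (mul_le_mul_of_nonneg_left (((hΩt v hzv).2).trans (le_abs_self R)) (Real.sqrt_nonneg _)) (Real.sqrt_nonneg _)) _) (by positivity) hCΩ0
  have hmom_i : Integrable (fun v : Edge 3 L → Fin 3 → ℝ => Ω (linkEmbed L v) * (Real.sqrt β * (Real.sqrt 2 * ‖linkEmbed L v‖)) ^ (3 * n)) π' := integrable_of_measurable_abs_le _ hmom_m hmom_b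
  have hΩvi : Integrable (fun v : Edge 3 L → Fin 3 → ℝ => Ω (linkEmbed L v)) π' := integrable_of_measurable_abs_le _ (hΩm.comp hle) fun v => hCΩ _
  have hGi : Integrable G π' := integrable_of_measurable_abs_le _ hGm hGb
  have hGmom_m : Measurable fun v : Edge 3 L → Fin 3 → ℝ => G v * (Real.sqrt β * (5 * (Real.sqrt 2 * ‖linkEmbed L v‖))) ^ (3 * n) :=
    hGm.mul ((((hle.norm.const_mul _).const_mul _).const_mul _).pow_const _)
  have hGmom_b : ∀ v : Edge 3 L → Fin 3 → ℝ, |G v * (Real.sqrt β * (5 * (Real.sqrt 2 * ‖linkEmbed L v‖))) ^ (3 * n)| ≤ CΩ * (Real.sqrt β * (5 * (Real.sqrt 2 * |R|))) ^ (3 * n) := fun v => by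
    by_cases hzv : Ω (linkEmbed L v) = 0
    · have : G v = 0 := le_antisymm (by rw [← hzv]; exact hGle v) (hG0 v)
      rw [this, zero_mul, abs_zero]; positivity
    · rw [abs_mul, abs_of_nonneg (hG0 v), abs_of_nonneg (by positivity : 0 ≤ (Real.sqrt β * (5 * (Real.sqrt 2 * ‖linkEmbed L v‖))) ^ (3 * n))]
      exact mul_le_mul ((hGle v).trans ((le_abs_self _).trans (hCΩ _))) (pow_le_pow_left₀ (by positivity)
        (mul_le_mul_of_nonneg_left (mul_le_mul_of_nonneg_left (mul_le_mul_of_nonneg_left (((hΩt v hzv).2).trans (le_abs_self R)) (Real.sqrt_nonneg _)) (by norm_num))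
          (Real.sqrt_nonneg _)) _) (by positivity) hCΩ0
  have hGmom_i : Integrable (fun v : Edge 3 L → Fin 3 → ℝ => G v * (Real.sqrt β * (5 * (Real.sqrt 2 * ‖linkEmbed L v‖))) ^ (3 * n)) π' := integrable_of_measurable_abs_le _ hGmom_m hGmom_b
  set I₀ : ℝ := ∫ v, Ω (linkEmbed L v) ∂π' with hI₀
  set Mm : ℝ := ∫ v, Ω (linkEmbed L v) * (Real.sqrt β * (Real.sqrt 2 * ‖linkEmbed L v‖)) ^ (3 * n) ∂π' with hMm
  set t₀' : ℝ := ∫ v, G v ∂π' with ht₀'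
  set tM : ℝ := ∫ v, G v * (Real.sqrt β * (5 * (Real.sqrt 2 * ‖linkEmbed L v‖))) ^ (3 * n) ∂π' with htM
  have hI₀0 : 0 ≤ I₀ := integral_nonneg fun v => hΩ0 _
  have hMm0 : 0 ≤ Mm := integral_nonneg fun v => mul_nonneg (hΩ0 _) (by positivity)
  have hstep : ∀ v : Edge 3 L → Fin 3 → ℝ, ∫ q, Φ (v, q) ∂π'.prod (gaugeMeasure L) ≤
      Cg * (G v * I₀ + G v * (Real.sqrt β * (5 * (Real.sqrt 2 * ‖linkEmbed L v‖))) ^ (3 * n) * I₀ + G v * Mm) := by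
    intro v
    rw [integral_prod _ (hsec v)]
    have hI1 : Integrable (fun v' => ∫ g, Φ (v, (v', g)) ∂gaugeMeasure L) π' := (hsec v).integral_prod_left
    have hrhs : Integrable (fun v' => G v * Ω (linkEmbed L v') * (Cg * (1 + (Real.sqrt β * (5 * (Real.sqrt 2 * ‖linkEmbed L v‖))) ^ (3 * n) +
        (Real.sqrt β * (Real.sqrt 2 * ‖linkEmbed L v'‖)) ^ (3 * n)))) π' := by
      have e : ∀ v', G v * Ω (linkEmbed L v') * (Cg * (1 + (Real.sqrt β * (5 * (Real.sqrt 2 * ‖linkEmbed L v‖))) ^ (3 * n) + (Real.sqrt β * (Real.sqrt 2 * ‖linkEmbed L v'‖)) ^ (3 * n))) =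
          (G v * Cg * (1 + (Real.sqrt β * (5 * (Real.sqrt 2 * ‖linkEmbed L v‖))) ^ (3 * n))) * Ω (linkEmbed L v') +
            (G v * Cg) * (Ω (linkEmbed L v') * (Real.sqrt β * (Real.sqrt 2 * ‖linkEmbed L v'‖)) ^ (3 * n)) := fun v' => by ring
      simp_rw [e]
      exact (hΩvi.const_mul _).add (hmom_i.const_mul _)
    refine (integral_mono hI1 hrhs (hinner_g v)).trans (le_of_eq ?_)
    have e : ∀ v', G v * Ω (linkEmbed L v') * (Cg * (1 + (Real.sqrt β * (5 * (Real.sqrt 2 * ‖linkEmbed L v‖))) ^ (3 * n) + (Real.sqrt β * (Real.sqrt 2 * ‖linkEmbed L v'‖)) ^ (3 * n))) =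
        (G v * Cg * (1 + (Real.sqrt β * (5 * (Real.sqrt 2 * ‖linkEmbed L v‖))) ^ (3 * n))) * Ω (linkEmbed L v') +
          (G v * Cg) * (Ω (linkEmbed L v') * (Real.sqrt β * (Real.sqrt 2 * ‖linkEmbed L v'‖)) ^ (3 * n)) := fun v' => by ring
    simp_rw [e]
    rw [integral_add (hΩvi.const_mul _) (hmom_i.const_mul _), integral_const_mul, integral_const_mul]
    ring
  have hJ1 : Integrable (fun v => ∫ q, Φ (v, q) ∂π'.prod (gaugeMeasure L)) π' := by
    have h : Integrable Φ (π'.prod (π'.prod (gaugeMeasure L))) := by rw [hμP] at hΦi; exact hΦi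
    exact h.integral_prod_left
  have hJ2 : Integrable (fun v => Cg * (G v * I₀ + G v * (Real.sqrt β * (5 * (Real.sqrt 2 * ‖linkEmbed L v‖))) ^ (3 * n) * I₀ + G v * Mm)) π' := by
    have e : ∀ v, Cg * (G v * I₀ + G v * (Real.sqrt β * (5 * (Real.sqrt 2 * ‖linkEmbed L v‖))) ^ (3 * n) * I₀ + G v * Mm) =
        (Cg * (I₀ + Mm)) * G v + (Cg * I₀) * (G v * (Real.sqrt β * (5 * (Real.sqrt 2 * ‖linkEmbed L v‖))) ^ (3 * n)) := fun v => by ring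
    simp_rw [e]
    exact (hGi.const_mul _).add (hGmom_i.const_mul _)
  have hΦint : ∫ p, Φ p ∂μP ≤ Cg * (t₀' * I₀ + tM * I₀ + t₀' * Mm) := by
    rw [hμP, integral_prod _ (by rw [hμP] at hΦi; exact hΦi)]
    refine (integral_mono hJ1 hJ2 hstep).trans (le_of_eq ?_)
    have e : ∀ v, Cg * (G v * I₀ + G v * (Real.sqrt β * (5 * (Real.sqrt 2 * ‖linkEmbed L v‖))) ^ (3 * n) * I₀ + G v * Mm) =
        (Cg * (I₀ + Mm)) * G v + (Cg * I₀) * (G v * (Real.sqrt β * (5 * (Real.sqrt 2 * ‖linkEmbed L v‖))) ^ (3 * n)) := fun v => by ring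
    simp_rw [e]
    rw [integral_add (hGi.const_mul _) (hGmom_i.const_mul _), integral_const_mul, integral_const_mul]
    ring
  -- the tail integrals as set integrals over `Rg`
  have ht₀'eq : t₀' = ∫ v in Rg, Ω (linkEmbed L v) ∂π' := by rw [ht₀', hG, integral_indicator hRgm]
  have htMeq : tM = ∫ v in Rg, Ω (linkEmbed L v) * (Real.sqrt β * (5 * (Real.sqrt 2 * ‖linkEmbed L v‖))) ^ (3 * n) ∂π' := by
    rw [htM, ← integral_indicator hRgm]
    refine integral_congr_ae (ae_of_all _ fun v => ?_)
    dsimp only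
    rw [hG]; dsimp only
    by_cases hv : v ∈ Rg
    · rw [Set.indicator_of_mem hv, Set.indicator_of_mem hv]
    · rw [Set.indicator_of_notMem hv, Set.indicator_of_notMem hv, zero_mul]
  rw [ht₀'eq, htMeq] at hΦint
  have h := hnum.trans (mul_le_mul_of_nonneg_left hΦint hK1p.le)
  rw [hμP, hπ] at h
  refine h.trans (le_of_eq ?_)
  rw [hK1, hCg, hsβ, hI₀, hMm, hπ]

set_option maxHeartbeats 800000 in
/-- ★★ **Total mass of the reference density from below, absolute form.**  With the fibre core `C ⊆ {capBalanced, ‖v̂‖ ≤ r₀, |v_{e,c}| ≤ t₀ ≤ 1/30}`, `0 < ρ ≤ 1`: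
`K₁(1,1)·c₁·fpZ ε·(ρ³/10)^n·(∫_C Ω)² ≤ ∫ρ₁ dμP`, `c₁ = exp(−β|E|(2ρ+2√2r₀)² − (β/2)(2(10√N_P r₀)² + 2E(t₀,0)))`. [cite: Luscher1983, §3] -/
theorem reference_mass_ge_floor {β : ℝ} (hβ : 0 < β) {Ω : LinkSpace L → ℝ} (hΩm : Measurable Ω) {CΩ : ℝ} (hCΩ : ∀ x, |Ω x| ≤ CΩ) (hΩ0 : ∀ x, 0 ≤ Ω x) {R : ℝ}
    (hΩt : ∀ v : Edge 3 L → Fin 3 → ℝ, Ω (linkEmbed L v) ≠ 0 → v ∈ capBalancedSet L ∧ ‖linkEmbed L v‖ ≤ R)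
    {C : Set (Edge 3 L → Fin 3 → ℝ)} (hC : MeasurableSet C) {r₀ t₀ : ℝ} (ht₀ : t₀ ≤ 1 / 30)
    (hCsub : ∀ v ∈ C, v ∈ capBalancedSet L ∧ ‖linkEmbed L v‖ ≤ r₀ ∧ ∀ (e : Edge 3 L) (c : Fin 3), |v e c| ≤ t₀) (ε : ℝ) {ρ : ℝ} (hρ : 0 < ρ) (hρ1 : ρ ≤ 1) :
    transferKernel su2Rep ((L : ℝ) ^ 3 * β) (1 : GaugeConfig 3 1 SU2) 1 *
        (Real.exp (-(β * ((Fintype.card (Edge 3 L) : ℝ) * (2 * ρ + 2 * Real.sqrt 2 * r₀) ^ 2)) -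
              β / 2 * (((10 * Real.sqrt (Fintype.card (Plaquette 3 L × Fin 3)) * r₀) ^ 2 + stepActionErr (L := L) t₀ 0) +
                ((10 * Real.sqrt (Fintype.card (Plaquette 3 L × Fin 3)) * r₀) ^ 2 + stepActionErr (L := L) t₀ 0))) *
          (fpZ ε * (ρ ^ 3 / 10) ^ Fintype.card {x : Site 3 L // ¬x = 0} * (∫ v in C, Ω (linkEmbed L v) ∂orthoTransverse L) ^ 2)) ≤
      ∫ p, fpTriple L β Ω (fpWeight L ε) 1 1 p ∂((orthoTransverse L).prod ((orthoTransverse L).prod (gaugeMeasure L))) := by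
  haveI := isFiniteMeasure_orthoTransverse L
  haveI : SecondCountableTopology SU2 := secondCountableTopology_su2
  set n : ℕ := Fintype.card {x : Site 3 L // ¬x = 0} with hn
  set π' := orthoTransverse L with hπ
  set μP : Measure ((Edge 3 L → Fin 3 → ℝ) × ((Edge 3 L → Fin 3 → ℝ) × (Site 3 L → SU2))) := π'.prod (π'.prod (gaugeMeasure L)) with hμP
  haveI : IsFiniteMeasure μP := by rw [hμP]; infer_instance
  set K1 : ℝ := transferKernel su2Rep ((L : ℝ) ^ 3 * β) (1 : GaugeConfig 3 1 SU2) 1 with hK1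
  have hK1p : 0 < K1 := transferKernel_pos _ _ _ _
  have hle : Measurable (linkEmbed L) := measurable_linkEmbed L
  have hfw : Measurable (fpWeight L ε) := measurable_fpWeight L ε
  have hCΩ0 : 0 ≤ CΩ := (abs_nonneg _).trans (hCΩ 0)
  have hexp1 : ∀ p : (Edge 3 L → Fin 3 → ℝ) × ((Edge 3 L → Fin 3 → ℝ) × (Site 3 L → SU2)), Real.exp (-(β * kinDefect L (orthoTube L 1 p.1) (orthoTube L 1 p.2.1) p.2.2)) ≤ 1 := fun p =>
    Real.exp_le_one_iff.mpr (by nlinarith [kinDefect_nonneg (orthoTube L 1 p.1) (orthoTube L 1 p.2.1) p.2.2, hβ.le])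
  -- the floor (as in `reference_tail_le`): `∫ρ₁ ≥ K1·c₁·fpZ(ρ³/10)^n θ²`
  set F : (Edge 3 L → Fin 3 → ℝ) × ((Edge 3 L → Fin 3 → ℝ) × (Site 3 L → SU2)) → ℝ := fun p => Ω (linkEmbed L p.1) * (fpWeight L ε p.2.2 * Ω (linkEmbed L p.2.1)) with hF
  set σ : (Edge 3 L → Fin 3 → ℝ) × ((Edge 3 L → Fin 3 → ℝ) × (Site 3 L → SU2)) → ℝ := fun p => fpTriple L β (fun _ => (1 : ℝ)) (fun _ => (1 : ℝ)) 1 1 p / K1 with hσ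
  have hσ_eq : ∀ p, σ p = transferKernel su2Rep β (orthoTube L 1 p.1) (gaugeTransform p.2.2 (orthoTube L 1 p.2.1)) / K1 := fun p => by
    rw [hσ]; dsimp only; unfold fpTriple; ring
  have hρ_eq : ∀ p, fpTriple L β Ω (fpWeight L ε) 1 1 p = K1 * (F p * σ p) := fun p => by
    rw [hσ_eq, hF]; dsimp only; unfold fpTriple; field_simp
  have hFm : Measurable F := by
    have a1 : Measurable fun p : (Edge 3 L → Fin 3 → ℝ) × ((Edge 3 L → Fin 3 → ℝ) × (Site 3 L → SU2)) => Ω (linkEmbed L p.1) := hΩm.comp (hle.comp measurable_fst)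
    have a2 : Measurable fun p : (Edge 3 L → Fin 3 → ℝ) × ((Edge 3 L → Fin 3 → ℝ) × (Site 3 L → SU2)) => fpWeight L ε p.2.2 := hfw.comp (measurable_snd.comp measurable_snd)
    have a3 : Measurable fun p : (Edge 3 L → Fin 3 → ℝ) × ((Edge 3 L → Fin 3 → ℝ) × (Site 3 L → SU2)) => Ω (linkEmbed L p.2.1) :=
      hΩm.comp (hle.comp (measurable_fst.comp measurable_snd))
    exact a1.mul (a2.mul a3)
  have hF0 : ∀ p, 0 ≤ F p := fun p => mul_nonneg (hΩ0 _) (mul_nonneg (fpWeight_mem_Icc L ε _).1 (hΩ0 _))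
  have hFb : ∀ p, F p ≤ CΩ * CΩ := fun p => by
    calc F p = Ω (linkEmbed L p.1) * (fpWeight L ε p.2.2 * Ω (linkEmbed L p.2.1)) := rfl
      _ ≤ CΩ * (1 * CΩ) := mul_le_mul ((le_abs_self _).trans (hCΩ _)) (mul_le_mul (fpWeight_mem_Icc L ε _).2 ((le_abs_self _).trans (hCΩ _)) (hΩ0 _) zero_le_one)
            (mul_nonneg (fpWeight_mem_Icc L ε _).1 (hΩ0 _)) hCΩ0
      _ = CΩ * CΩ := by ring
  have hσm : Measurable σ := (measurable_fpTriple β measurable_const measurable_const 1 1).div_const _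
  have hσ0 : ∀ p, 0 ≤ σ p := fun p => by rw [hσ_eq]; exact div_nonneg (transferKernel_pos _ _ _ _).le hK1p.le
  have hσ1 : ∀ p, σ p ≤ 1 := fun p => by rw [hσ_eq]; exact (kernelRatio_le hβ.le p.1 p.2.1 p.2.2).trans (hexp1 p)
  set D₀ : ℝ := (Fintype.card (Edge 3 L) : ℝ) * (2 * ρ + 2 * Real.sqrt 2 * r₀) ^ 2 with hD₀
  set c₁ : ℝ := Real.exp (-(β * D₀) - β / 2 * (((10 * Real.sqrt (Fintype.card (Plaquette 3 L × Fin 3)) * r₀) ^ 2 + stepActionErr (L := L) t₀ 0) +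
      ((10 * Real.sqrt (Fintype.card (Plaquette 3 L × Fin 3)) * r₀) ^ 2 + stepActionErr (L := L) t₀ 0))) with hc₁
  have hc₁p : 0 < c₁ := Real.exp_pos _
  set A : Set ((Edge 3 L → Fin 3 → ℝ) × ((Edge 3 L → Fin 3 → ℝ) × (Site 3 L → SU2))) :=
    {p | kinDefect L (orthoTube L 1 p.1) (orthoTube L 1 p.2.1) p.2.2 ≤ D₀} ∩ C ×ˢ (C ×ˢ (Set.univ : Set (Site 3 L → SU2))) with hA
  have hAm : MeasurableSet A := (measurableSet_tubeKinLevelSet (L := L) D₀).inter (hC.prod (hC.prod MeasurableSet.univ))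
  have hΩt' : ∀ v : Edge 3 L → Fin 3 → ℝ, Ω (linkEmbed L v) ≠ 0 → v ∈ capBalancedSet L := fun v hv => (hΩt v hv).1
  have hfloorF : fpZ ε * (ρ ^ 3 / 10) ^ n * (∫ v in C, Ω (linkEmbed L v) ∂π') ^ 2 ≤ ∫ p in A, F p ∂μP := by
    rw [hμP, hπ, hA, hF]; exact setIntegral_profile_kinLevelSet_ge (L := L) hΩm hCΩ hΩ0 hΩt' hC (fun v hv => (hCsub v hv).2.1) ε hρ hρ1
  have hσA : ∀ p ∈ A, c₁ ≤ σ p := by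
    rintro ⟨v, v', g⟩ ⟨hk, hP⟩
    have hvC : v ∈ C := (Set.mem_prod.mp hP).1
    have hv'C : v' ∈ C := (Set.mem_prod.mp (Set.mem_prod.mp hP).2).1
    obtain ⟨hvc, hvr, hvt⟩ := hCsub v hvC
    obtain ⟨hv'c, hv'r, hv't⟩ := hCsub v' hv'C
    have hk' : kinDefect L (orthoTube L 1 v) (orthoTube L 1 v') g ≤ D₀ := hk
    have h := kernelRatio_ge_on_levelSet (L := L) hβ.le hvc hv'c ht₀ hvt hv't hk'
    rw [hσ_eq]
    refine le_trans ?_ h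
    rw [hc₁]
    refine Real.exp_le_exp.mpr ?_
    have hN0' : 0 ≤ 10 * Real.sqrt (Fintype.card (Plaquette 3 L × Fin 3) : ℝ) := by positivity
    have h1 : (10 * Real.sqrt (Fintype.card (Plaquette 3 L × Fin 3)) * ‖linkEmbed L v‖) ^ 2 ≤ (10 * Real.sqrt (Fintype.card (Plaquette 3 L × Fin 3)) * r₀) ^ 2 :=
      pow_le_pow_left₀ (by positivity) (mul_le_mul_of_nonneg_left hvr hN0') 2
    have h2 : (10 * Real.sqrt (Fintype.card (Plaquette 3 L × Fin 3)) * ‖linkEmbed L v'‖) ^ 2 ≤ (10 * Real.sqrt (Fintype.card (Plaquette 3 L × Fin 3)) * r₀) ^ 2 :=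
      pow_le_pow_left₀ (by positivity) (mul_le_mul_of_nonneg_left hv'r hN0') 2
    have hβ2 : 0 ≤ β / 2 := by linarith
    nlinarith [mul_le_mul_of_nonneg_left (add_le_add h1 h2) hβ2]
  have hFσm : Measurable fun p => F p * σ p := hFm.mul hσm
  have hFσ0 : ∀ p, 0 ≤ F p * σ p := fun p => mul_nonneg (hF0 p) (hσ0 p)
  have hFσi : Integrable (fun p => F p * σ p) μP :=
    integrable_of_measurable_abs_le _ hFσm (C := CΩ * CΩ * 1) fun p => by rw [abs_of_nonneg (hFσ0 p)]; exact mul_le_mul (hFb p) (hσ1 p) (hσ0 p) (mul_nonneg hCΩ0 hCΩ0)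
  have hFi : Integrable F μP := integrable_of_measurable_abs_le _ hFm (C := CΩ * CΩ) fun p => by rw [abs_of_nonneg (hF0 p)]; exact hFb p
  have hden : c₁ * (fpZ ε * (ρ ^ 3 / 10) ^ n * (∫ v in C, Ω (linkEmbed L v) ∂π') ^ 2) ≤ ∫ p, F p * σ p ∂μP := by
    calc c₁ * (fpZ ε * (ρ ^ 3 / 10) ^ n * (∫ v in C, Ω (linkEmbed L v) ∂π') ^ 2) ≤ c₁ * ∫ p in A, F p ∂μP := mul_le_mul_of_nonneg_left hfloorF hc₁p.le
      _ = ∫ p in A, c₁ * F p ∂μP := (integral_const_mul _ _).symm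
      _ ≤ ∫ p in A, F p * σ p ∂μP := setIntegral_mono_on (hFi.const_mul c₁).integrableOn hFσi.integrableOn hAm fun p hp => by
          rw [mul_comm]; exact mul_le_mul_of_nonneg_left (hσA p hp) (hF0 p)
      _ ≤ ∫ p, F p * σ p ∂μP := setIntegral_le_integral hFσi (ae_of_all _ hFσ0)
  have e2 : ∫ p, fpTriple L β Ω (fpWeight L ε) 1 1 p ∂μP = K1 * ∫ p, F p * σ p ∂μP := by
    rw [← integral_const_mul]; exact integral_congr_ae (ae_of_all _ fun p => hρ_eq p)
  rw [e2]
  rw [hμP, hπ] at hden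
  have h := mul_le_mul_of_nonneg_left hden hK1p.le
  refine le_trans (le_of_eq ?_) h
  rw [hK1, hc₁, hπ]

end Summit.QuantumFields.YangMills.Theorems.FemtoTransferGap.RateTube

end
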